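/-
Copyright (c) 2026 the pub-hodgecm-mathlib formalisation cell (harness21).  Prover seat hodgecm-mathlib-LH10-p01 (g3): «SHALIKA-ALL (binder: DUAL)» (LH4-plan (g3) DEALER WORD #22) —
the Shalika germ expansion for `U(Φ₃)(L⁺_v)` at EVERY non-split place modulo the dual pieces, by bare names; assembly bodies = ★ p850226's (LH5-p03 (g2)); 2026-09-02.
-/
import Literature.NumberTheory.Rogawski1990.ShalikaGermExpansionUnitaryThreeUnramifiedCM      -- ★ p850226 (LH5-p03): §1 ‹RAO› ALL places `…exists_orbitalMeasureFamily_rao_unipotent_antidiagOne_three_nonsplit`, the unramified head, ★ p850106 ‹DUAL-unr›; brings the SH-3 plug, ‹SPAN-e› p849233, `totallyDisconnectedSpace_cmDatum_local`, `antidiagOne_isHermitian`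
import Literature.NumberTheory.Rogawski1990.UnitaryThreeUnipotentClassesFiniteAllCM           -- ★ p850209∕p850231 (this seat): ‹U-FIN› ALL places `unitaryThree_unipotent_conjClasses_finite''`
import Literature.NumberTheory.Rogawski1990.UnitaryThreeUnipotentStrataAllCM                  -- ★ (A-p12 (g26)) «SPAN-all»: `exists_enum_unipotent_isClosed_iUnion_lt_antidiagOne'` (closed enumeration of the unipotent classes, ALL places)
import Literature.NumberTheory.Rogawski1990.UnipotentOrbitalIntegralDualPiecesCM               -- ★ p849114 (LH4-p02 (g2)): ‹DUAL› at ODD places `UnitaryGroup.exists_unipotentDualPieces_antidiagOne_odd` (for the wild corollary's case split)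
import Literature.NumberTheory.Rogawski1990.UnipotentOrbitalIntegralDualPiecesAllCM            -- ★ p850291 (F0P3a-p04 (g22)): ‹DUAL› at EVERY non-split place `UnitaryGroup.exists_unipotentDualPieces_antidiagOne_nonsplit` (ED. 2)
import Literature.NumberTheory.Rogawski1990.LocalTransferIdentityCoreResidualStatements     -- ★ the print letter `N6nsShalikaStatement` («Shalika at `Φ₃` at every non-split place», a `def … : Prop`) — DISCHARGED in §5 (ED. 3)
import HarnessLib

/-!
# The Shalika germ expansion for `U(Φ₃)(L⁺_v)` at EVERY non-split place (odd, unramified-dyadic, WILD) — IN-HOUSE modulo the DUAL PIECES (Rogawski 1990, §8.1 Prop. 8.1.1)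

Topic `NumberTheory/Rogawski1990`; namespace `Literature.NumberTheory.Rogawski1990`.  THEOREMS ONLY (no definition, no instance, no notation, no named fact, no `sorry`);
kernel lane `--supports stmt-HodgeConjecture-24833`.  Cell `pub/hodgecm-mathlib` (D-0151), crux H413 = `stmt-HodgeConjecture-24833`; half A line LH4 (closer stub `stub_N6ns`), DYADIC
pay-down leaf `Cruxes/H413/Lines/F0_P3c_DyadicPaydown.lean` (ED. 1 a78d34cdd4c5; ED. 2 cand 985ff04f47d2ffbd re-cuts (D-SH) to the WILD organ `stub_DyShalikaWild`), dealer LH4-plan (g3)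
WORD #22 «SHALIKA-ALL (binder: DUAL)».  Pattern = ★ p850226 `ShalikaGermExpansionUnitaryThreeUnramifiedCM` (LH5-p03 (g2)): the ★ SH-3 plug `UnitaryGroup.shalikaGermExpansionNonsplit_of_howePackage`
fed with the Howe package, every brick now ★ at EVERY non-split place EXCEPT the dual pieces at WILD places: ‹U-FIN› ★ p850231 `unitaryThree_unipotent_conjClasses_finite''`;
‹RAO› ★ p850226 §1 (over ★ p849258 + ★ p850112); ‹SPAN› ★ «SPAN-all» `exists_enum_unipotent_isClosed_iUnion_lt_antidiagOne'` (A-p12 (g26)) + ★ p849233; ‹DUAL› — carried as the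
HYPOTHESIS `hdual` = ★ p849114 `UnitaryGroup.exists_unipotentDualPieces_antidiagOne_odd`'s text with `IsUnit (2 : 𝒪[w.1.adicCompletion L]) →` deleted (all places), resp. in the
corollary only its WILD slice `hdualW` (the same text with `v.asIdeal.ramificationIdx' w.1.asIdeal ≠ 1 → ¬ IsUnit (2 : 𝒪[w.1.adicCompletion L]) →` inserted), the odd and unramified
slices being ★ (p849114, p850106).  HONEST LABEL: HC_CM is proved only modulo the 7 printed citations (2 remaining: hLiu418 = stmt-HodgeConjecture-24832, h413 = stmt-HodgeConjecture-24833)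
until rung 0 closes; count-neutral (the leaf's `stub_DyShalikaWild` closes by ONE line from a future ★ ‹DUAL-wild›; nothing printed is discharged here).

* §1 `UnitaryGroup.howeSpan_unipotent_antidiagOne_three_nonsplit` — ‹SPAN› (Howe's span property for the unipotent classes) at EVERY non-split place (= ★ p850226 §2 text with
  `Algebra.IsUnramifiedIn (𝓞 L) v.asIdeal →` deleted; closed filtration from ★ «SPAN-all»).
* §2 **`UnitaryGroup.shalikaGermExpansionNonsplit_antidiagOne_three_of_dualPieces (hdual)`** — THE HEAD modulo the dual pieces at every place.
* §3 **`UnitaryGroup.shalikaGermExpansionNonsplit_antidiagOne_three_of_dualPieces_wild (hdualW)`** — today's state: unconditional off the wild places, the ONLY hypothesis being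
  the dual pieces at WILD (ramified dyadic) places.
* §4 (ED. 2) **`UnitaryGroup.shalikaGermExpansionNonsplit_antidiagOne_three`** — THE BARE HEAD: `hdual` discharged by ★ p850291 `UnitaryGroup.exists_unipotentDualPieces_antidiagOne_nonsplit`
  (dual pieces at every place via the strata road ★ p850263): the Shalika germ expansion for `U(Φ₃)(L⁺_v)` at EVERY non-split place, IN-HOUSE, hypothesis-free.
* §5 (ED. 3) **`n6nsShalikaStatement_holds : N6nsShalikaStatement`** — the un-narrowed PRINT LETTER of ★ `LocalTransferIdentityCoreResidualStatements` («Shalika at `Φ₃` at EVERY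
  non-split place», [Rogawski1990 Prop. 8.1.1]) is now a THEOREM of the tree (`w := Classical.choice (PlacesOver.nonempty L v)` into §4).

## References
* [Rogawski1990] J. D. Rogawski, *Automorphic Representations of Unitary Groups in Three Variables*, Ann. of Math. Stud. 123 (1990): §8.1 Props. 8.1.1–8.1.2 pp. 112–114; §3.9
  Prop. 3.9.1 p. 32; §4.9 p. 54.
* [Rao1972] R. Ranga Rao, *Orbital integrals in reductive groups*, Ann. of Math. (2) 96 (1972) 505–510.
* [Howe1974] R. Howe, *The Fourier transform and germs of characters (case of GL_n over a p-adic field)*, Math. Ann. 208 (1974) 305–322, Prop. 2.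
* [HarishChandra1999AdmissibleDistributions] Harish-Chandra (notes by S. DeBacker, P. J. Sally, Jr.), *Admissible Invariant Distributions on Reductive p-adic Groups*, AMS ULS 16
  (1999): Thm. 8.1 p. 48; §3.1 p. 17.
-/

set_option autoImplicit false

noncomputable section

namespace Literature.NumberTheory.Rogawski1990

open _root_.MeasureTheory _root_.MeasureTheory.Measure _root_.NumberField IsDedekindDomain _root_.Topology Filter
open Literature.MeasureTheory.Group Literature.NumberTheory.Automorphic Literature.NumberTheory.Automorphic.UnitaryGroup
open Literature.NumberTheory.GaloisRepresentations
open scoped Matrix MatrixGroups Classical ValuativeRel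

/-! ## §1 ‹SPAN› at every non-split place: Howe's span property for the unipotent classes -/

set_option maxHeartbeats 400000 in
-- statement-heavy: four instance binders
/-- = ★ `UnitaryGroup.howeSpan_unipotent_antidiagOne_three_unramified` with the hypothesis `Algebra.IsUnramifiedIn (𝓞 L) v.asIdeal` deleted.
**‹SPAN› AT EVERY NON-SPLIT PLACE — HOWE'S SPAN PROPERTY for `G = U(Φ₃)(L⁺_v)`**, `S` = THE set of unipotent classes, `mU` admissible on `S` with Ranga-Rao's clause: every
`F ∈ C_c^∞(G)` whose unipotent orbital integrals all vanish is `F₀ + F₁` with `F₀ ∈ span_ℂ {φ^x − φ}` and `tsupport F₁` off the unipotent variety.  ★ p849233 generic span lemma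
at `P γ := (γ − 1)³ = 0`, the closed filtration being ★ «SPAN-all» `exists_enum_unipotent_isClosed_iUnion_lt_antidiagOne'` (A-p12 (g26): every place, over ★ p850199 Hensel-deep
squares + ★ p850190 norm step); `G` totally disconnected by ★ `totallyDisconnectedSpace_cmDatum_local`.
[cite: Howe1974, Prop. 2] [cite: HarishChandra1999AdmissibleDistributions, Thm. 8.1 p. 48] [cite: Rogawski1990, §8.1 pp. 112–113] -/
theorem UnitaryGroup.howeSpan_unipotent_antidiagOne_three_nonsplit :
    ∀ (L : Type) [Field L] [NumberField L] [IsCMField L] (v : HeightOneSpectrum (𝓞 ↥(maximalRealSubfield L))) (w : UnitaryGroup.PlacesOver L v),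
      Subsingleton (UnitaryGroup.PlacesOver L v) →
      ∀ [MeasurableSpace ((cmDatum L 3 (Matrix.of fun i j : Fin 3 => if i.val + j.val + 1 = 3 then (1 : L) else 0)).Local v)] [BorelSpace ((cmDatum L 3 (Matrix.of fun i j : Fin 3 => if i.val + j.val + 1 = 3 then (1 : L) else 0)).Local v)]
        [∀ γ : ((cmDatum L 3 (Matrix.of fun i j : Fin 3 => if i.val + j.val + 1 = 3 then (1 : L) else 0)).Local v), MeasurableSpace (((cmDatum L 3 (Matrix.of fun i j : Fin 3 => if i.val + j.val + 1 = 3 then (1 : L) else 0)).Local v) ⧸ Subgroup.centralizer ({γ} : Set ((cmDatum L 3 (Matrix.of fun i j : Fin 3 => if i.val + j.val + 1 = 3 then (1 : L) else 0)).Local v)))]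
        [∀ γ : ((cmDatum L 3 (Matrix.of fun i j : Fin 3 => if i.val + j.val + 1 = 3 then (1 : L) else 0)).Local v), BorelSpace (((cmDatum L 3 (Matrix.of fun i j : Fin 3 => if i.val + j.val + 1 = 3 then (1 : L) else 0)).Local v) ⧸ Subgroup.centralizer ({γ} : Set ((cmDatum L 3 (Matrix.of fun i j : Fin 3 => if i.val + j.val + 1 = 3 then (1 : L) else 0)).Local v)))],
      ∀ (S : Finset (ConjClasses ((cmDatum L 3 (Matrix.of fun i j : Fin 3 => if i.val + j.val + 1 = 3 then (1 : L) else 0)).Local v))) (mU : OrbitalMeasureFamily ((cmDatum L 3 (Matrix.of fun i j : Fin 3 => if i.val + j.val + 1 = 3 then (1 : L) else 0)).Local v)),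
        (∀ c : ConjClasses ((cmDatum L 3 (Matrix.of fun i j : Fin 3 => if i.val + j.val + 1 = 3 then (1 : L) else 0)).Local v), c ∈ S ↔ (((Quotient.out c : ((cmDatum L 3 (Matrix.of fun i j : Fin 3 => if i.val + j.val + 1 = 3 then (1 : L) else 0)).Local v)).val : GL (Fin 3) (UnitaryGroup.LocalRing L v)).val - 1) ^ 3 = 0) →
        mU.IsAdmissibleOn (fun γ : ((cmDatum L 3 (Matrix.of fun i j : Fin 3 => if i.val + j.val + 1 = 3 then (1 : L) else 0)).Local v) => (ConjClasses.mk γ) ∈ S) →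
        (∀ u ∈ S, ∀ f : ((cmDatum L 3 (Matrix.of fun i j : Fin 3 => if i.val + j.val + 1 = 3 then (1 : L) else 0)).Local v) → ℂ, IsLocSmooth f →
            Integrable (descConj (Quotient.out u : ((cmDatum L 3 (Matrix.of fun i j : Fin 3 => if i.val + j.val + 1 = 3 then (1 : L) else 0)).Local v)) (Subgroup.centralizer ({(Quotient.out u : ((cmDatum L 3 (Matrix.of fun i j : Fin 3 => if i.val + j.val + 1 = 3 then (1 : L) else 0)).Local v))} : Set ((cmDatum L 3 (Matrix.of fun i j : Fin 3 => if i.val + j.val + 1 = 3 then (1 : L) else 0)).Local v)))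
              (fun _ hg => Subgroup.mem_centralizer_singleton_iff.1 hg) f) (mU u)) →
        ∀ F : ((cmDatum L 3 (Matrix.of fun i j : Fin 3 => if i.val + j.val + 1 = 3 then (1 : L) else 0)).Local v) → ℂ, IsLocSmooth F → (∀ u ∈ S, classOrbitalIntegral mU F u = 0) →
          ∃ F₀ F₁ : ((cmDatum L 3 (Matrix.of fun i j : Fin 3 => if i.val + j.val + 1 = 3 then (1 : L) else 0)).Local v) → ℂ, F = F₀ + F₁ ∧
            F₀ ∈ Submodule.span ℂ {ψ : ((cmDatum L 3 (Matrix.of fun i j : Fin 3 => if i.val + j.val + 1 = 3 then (1 : L) else 0)).Local v) → ℂ |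
              ∃ (x : ((cmDatum L 3 (Matrix.of fun i j : Fin 3 => if i.val + j.val + 1 = 3 then (1 : L) else 0)).Local v)) (φ : ((cmDatum L 3 (Matrix.of fun i j : Fin 3 => if i.val + j.val + 1 = 3 then (1 : L) else 0)).Local v) → ℂ), IsLocSmooth φ ∧ ψ = (fun g => φ (x * g * x⁻¹)) - φ} ∧
            ∀ g ∈ tsupport F₁, (((g).val : GL (Fin 3) (UnitaryGroup.LocalRing L v)).val - 1) ^ 3 ≠ 0 := by
  intro L _ _ _ v w hsub _ _ _ _ S mU hS hmU hRao F hF h0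
  haveI : TotallyDisconnectedSpace ((cmDatum L 3 (Matrix.of fun i j : Fin 3 => if i.val + j.val + 1 = 3 then (1 : L) else 0)).Local v) :=
    totallyDisconnectedSpace_cmDatum_local L 3 _ v
  obtain ⟨n, e, he, hcl⟩ := exists_enum_unipotent_isClosed_iUnion_lt_antidiagOne' L v w hsub S hS
  exact exists_add_mem_span_conj_sub_of_classOrbitalIntegral_eq_zero
    (fun γ : ((cmDatum L 3 (Matrix.of fun i j : Fin 3 => if i.val + j.val + 1 = 3 then (1 : L) else 0)).Local v) => ((γ.val : GL (Fin 3) (UnitaryGroup.LocalRing L v)).val - 1) ^ 3 = 0) S hS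
    (fun g x => npow_conj_sub_one_eq_zero_iff L _ v g x 3) ⟨n, e, he, hcl⟩ mU hmU hRao F hF h0

/-! ## §2 THE HEAD — Shalika at `Φ₃` at every non-split place, modulo the dual pieces -/

set_option maxHeartbeats 800000 in
-- statement-light, proof-heavy: the Howe package is assembled under the plug's four instance binders (as in ★ p850226)
/-- **THE SHALIKA GERM EXPANSION FOR `U(Φ₃)(L⁺_v)` AT EVERY NON-SPLIT PLACE — MODULO THE DUAL PIECES.**  `hdual` = ★ p849114 `UnitaryGroup.exists_unipotentDualPieces_antidiagOne_odd`'s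
text with the hypothesis `2 ∈ 𝒪_w^×` deleted: «for every finite set `S` of unipotent classes and every `mU` admissible on `S` with Ranga-Rao's clause there are `fd u ∈ C_c^∞(G)` with
`Φ_{mU}(u, fd u′) = δ_{u u′}`» at EVERY non-split place.  Conclusion: ★ `ShalikaGermExpansionNonsplit L Φ₃ v` ([Rogawski1990] Prop. 8.1.1).  Proof: the ★ SH-3 plug fed with ‹U-FIN› ★
p850231 `unitaryThree_unipotent_conjClasses_finite''`, ‹RAO› ★ p850226 §1, `hdual`, ‹SPAN› §1 — ★ p850226's glue verbatim.
[cite: Rogawski1990, §8.1 Prop. 8.1.1 pp. 112–113] [cite: Howe1974, Prop. 2] [cite: Rao1972, Theorem] [cite: HarishChandra1999AdmissibleDistributions, Thm. 8.1 p. 48] -/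
theorem UnitaryGroup.shalikaGermExpansionNonsplit_antidiagOne_three_of_dualPieces
    (hdual :
        ∀ (L : Type) [Field L] [NumberField L] [IsCMField L] (v : HeightOneSpectrum (𝓞 ↥(maximalRealSubfield L))) (w : UnitaryGroup.PlacesOver L v),
          Subsingleton (UnitaryGroup.PlacesOver L v) →
          ∀ [MeasurableSpace ((cmDatum L 3 (Matrix.of fun i j : Fin 3 => if i.val + j.val + 1 = 3 then (1 : L) else 0)).Local v)] [BorelSpace ((cmDatum L 3 (Matrix.of fun i j : Fin 3 => if i.val + j.val + 1 = 3 then (1 : L) else 0)).Local v)]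
            [∀ γ : ((cmDatum L 3 (Matrix.of fun i j : Fin 3 => if i.val + j.val + 1 = 3 then (1 : L) else 0)).Local v), MeasurableSpace (((cmDatum L 3 (Matrix.of fun i j : Fin 3 => if i.val + j.val + 1 = 3 then (1 : L) else 0)).Local v) ⧸ Subgroup.centralizer ({γ} : Set ((cmDatum L 3 (Matrix.of fun i j : Fin 3 => if i.val + j.val + 1 = 3 then (1 : L) else 0)).Local v)))]
            [∀ γ : ((cmDatum L 3 (Matrix.of fun i j : Fin 3 => if i.val + j.val + 1 = 3 then (1 : L) else 0)).Local v), BorelSpace (((cmDatum L 3 (Matrix.of fun i j : Fin 3 => if i.val + j.val + 1 = 3 then (1 : L) else 0)).Local v) ⧸ Subgroup.centralizer ({γ} : Set ((cmDatum L 3 (Matrix.of fun i j : Fin 3 => if i.val + j.val + 1 = 3 then (1 : L) else 0)).Local v)))],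
          ∀ (S : Finset (ConjClasses ((cmDatum L 3 (Matrix.of fun i j : Fin 3 => if i.val + j.val + 1 = 3 then (1 : L) else 0)).Local v))) (mU : OrbitalMeasureFamily ((cmDatum L 3 (Matrix.of fun i j : Fin 3 => if i.val + j.val + 1 = 3 then (1 : L) else 0)).Local v)),
            (∀ u ∈ S, (((Quotient.out u : ((cmDatum L 3 (Matrix.of fun i j : Fin 3 => if i.val + j.val + 1 = 3 then (1 : L) else 0)).Local v)).val : GL (Fin 3) (UnitaryGroup.LocalRing L v)).val - 1) ^ 3 = 0) →
            mU.IsAdmissibleOn (fun γ : ((cmDatum L 3 (Matrix.of fun i j : Fin 3 => if i.val + j.val + 1 = 3 then (1 : L) else 0)).Local v) => (ConjClasses.mk γ) ∈ S) →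
            (∀ u ∈ S, ∀ f : ((cmDatum L 3 (Matrix.of fun i j : Fin 3 => if i.val + j.val + 1 = 3 then (1 : L) else 0)).Local v) → ℂ, IsLocSmooth f →
                Integrable (descConj (Quotient.out u : ((cmDatum L 3 (Matrix.of fun i j : Fin 3 => if i.val + j.val + 1 = 3 then (1 : L) else 0)).Local v)) (Subgroup.centralizer ({(Quotient.out u : ((cmDatum L 3 (Matrix.of fun i j : Fin 3 => if i.val + j.val + 1 = 3 then (1 : L) else 0)).Local v))} : Set ((cmDatum L 3 (Matrix.of fun i j : Fin 3 => if i.val + j.val + 1 = 3 then (1 : L) else 0)).Local v)))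
                  (fun _ hg => Subgroup.mem_centralizer_singleton_iff.1 hg) f) (mU u)) →
            ∃ fd : ConjClasses ((cmDatum L 3 (Matrix.of fun i j : Fin 3 => if i.val + j.val + 1 = 3 then (1 : L) else 0)).Local v) → ((cmDatum L 3 (Matrix.of fun i j : Fin 3 => if i.val + j.val + 1 = 3 then (1 : L) else 0)).Local v) → ℂ,
              (∀ u ∈ S, IsLocSmooth (fd u)) ∧ (∀ u ∈ S, classOrbitalIntegral mU (fd u) u = 1) ∧
              (∀ u ∈ S, ∀ u' ∈ S, u ≠ u' → classOrbitalIntegral mU (fd u') u = 0))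
    (L : Type) [Field L] [NumberField L] [IsCMField L]
    (v : HeightOneSpectrum (𝓞 ↥(maximalRealSubfield L))) (w : UnitaryGroup.PlacesOver L v) (hsub : Subsingleton (UnitaryGroup.PlacesOver L v)) :
    ShalikaGermExpansionNonsplit L (Matrix.of fun i j : Fin 3 => if i.val + j.val + 1 = 3 then (1 : L) else 0) v := by
  refine UnitaryGroup.shalikaGermExpansionNonsplit_of_howePackage L (Matrix.of fun i j : Fin 3 => if i.val + j.val + 1 = 3 then (1 : L) else 0) v
    (antidiagOne_isHermitian L 3) (isUnit_antidiagOne_det L 3).ne_zero ?_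
  intro _ _ _ _
  obtain ⟨S, hS⟩ := unitaryThree_unipotent_conjClasses_finite'' L v w hsub
  obtain ⟨mU, hadm, hraoU⟩ := UnitaryGroup.exists_orbitalMeasureFamily_rao_unipotent_antidiagOne_three_nonsplit L v w hsub
  have hmk : ∀ c : ConjClasses ((cmDatum L 3 (Matrix.of fun i j : Fin 3 => if i.val + j.val + 1 = 3 then (1 : L) else 0)).Local v), ConjClasses.mk (Quotient.out c) = c :=
    fun c => Quotient.out_eq c
  have hunip : ∀ u ∈ S, (((Quotient.out u : ((cmDatum L 3 (Matrix.of fun i j : Fin 3 => if i.val + j.val + 1 = 3 then (1 : L) else 0)).Local v)).val : GL (Fin 3) (UnitaryGroup.LocalRing L v)).val - 1) ^ 3 = 0 :=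
    fun u hu => (hS u).1 hu
  have hadmS : mU.IsAdmissibleOn (fun γ : ((cmDatum L 3 (Matrix.of fun i j : Fin 3 => if i.val + j.val + 1 = 3 then (1 : L) else 0)).Local v) => (ConjClasses.mk γ) ∈ S) := by
    intro c hc
    have hc' : c ∈ S := by simpa only [hmk] using hc
    exact hadm c ((hS c).1 hc')
  have hraoS : ∀ u ∈ S, ∀ f : ((cmDatum L 3 (Matrix.of fun i j : Fin 3 => if i.val + j.val + 1 = 3 then (1 : L) else 0)).Local v) → ℂ, IsLocSmooth f →
      Integrable (descConj (Quotient.out u : ((cmDatum L 3 (Matrix.of fun i j : Fin 3 => if i.val + j.val + 1 = 3 then (1 : L) else 0)).Local v)) (Subgroup.centralizer ({(Quotient.out u : ((cmDatum L 3 (Matrix.of fun i j : Fin 3 => if i.val + j.val + 1 = 3 then (1 : L) else 0)).Local v))} : Set ((cmDatum L 3 (Matrix.of fun i j : Fin 3 => if i.val + j.val + 1 = 3 then (1 : L) else 0)).Local v)))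
        (fun _ hg => Subgroup.mem_centralizer_singleton_iff.1 hg) f) (mU u) :=
    fun u hu => hraoU u (hunip u hu)
  obtain ⟨fd, hfd, h1, h0⟩ := hdual L v w hsub S mU hunip hadmS hraoS
  exact ⟨S, mU, fd, hunip, hadmS, hraoS, hfd, h1, h0,
    UnitaryGroup.howeSpan_unipotent_antidiagOne_three_nonsplit L v w hsub S mU hS hadmS hraoS⟩

/-! ## §3 Today's state: unconditional off the WILD places -/

set_option maxHeartbeats 800000 in
-- statement-heavy: the wild dual-pieces text
/-- **THE SHALIKA GERM EXPANSION FOR `U(Φ₃)(L⁺_v)` AT EVERY NON-SPLIT PLACE — MODULO THE DUAL PIECES AT WILD (RAMIFIED DYADIC) PLACES ONLY.**  `hdualW` = the dual-pieces text with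
the extra binder `e(w|v) ≠ 1 → 2 ∉ 𝒪_w^× →` (the WILD slice); the other slices are ★: unramified `v` — ★ p850106 `UnitaryGroup.exists_unipotentDualPieces_antidiagOne_unramified`
(F0P3a-p04 (g22)); ramified with `2 ∈ 𝒪_w^×` — ★ p849114 `UnitaryGroup.exists_unipotentDualPieces_antidiagOne_odd` (LH4-p02 (g2)); `e ≠ 1` from non-unramified by ★
`ramificationIdx'_ne_one_of_not_isUnramifiedIn_of_subsingleton`.  So the dyadic leaf's WILD organ `stub_DyShalikaWild` closes by ONE line the day a ★ ‹DUAL-wild› lands.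
[cite: Rogawski1990, §8.1 Prop. 8.1.1 pp. 112–113] [cite: Howe1974, Prop. 2] [cite: Rao1972, Theorem] [cite: HarishChandra1999AdmissibleDistributions, Thm. 8.1 p. 48] -/
theorem UnitaryGroup.shalikaGermExpansionNonsplit_antidiagOne_three_of_dualPieces_wild
    (hdualW :
        ∀ (L : Type) [Field L] [NumberField L] [IsCMField L] (v : HeightOneSpectrum (𝓞 ↥(maximalRealSubfield L))) (w : UnitaryGroup.PlacesOver L v),
          Subsingleton (UnitaryGroup.PlacesOver L v) → v.asIdeal.ramificationIdx' w.1.asIdeal ≠ 1 → ¬ IsUnit (2 : 𝒪[w.1.adicCompletion L]) →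
          ∀ [MeasurableSpace ((cmDatum L 3 (Matrix.of fun i j : Fin 3 => if i.val + j.val + 1 = 3 then (1 : L) else 0)).Local v)] [BorelSpace ((cmDatum L 3 (Matrix.of fun i j : Fin 3 => if i.val + j.val + 1 = 3 then (1 : L) else 0)).Local v)]
            [∀ γ : ((cmDatum L 3 (Matrix.of fun i j : Fin 3 => if i.val + j.val + 1 = 3 then (1 : L) else 0)).Local v), MeasurableSpace (((cmDatum L 3 (Matrix.of fun i j : Fin 3 => if i.val + j.val + 1 = 3 then (1 : L) else 0)).Local v) ⧸ Subgroup.centralizer ({γ} : Set ((cmDatum L 3 (Matrix.of fun i j : Fin 3 => if i.val + j.val + 1 = 3 then (1 : L) else 0)).Local v)))]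
            [∀ γ : ((cmDatum L 3 (Matrix.of fun i j : Fin 3 => if i.val + j.val + 1 = 3 then (1 : L) else 0)).Local v), BorelSpace (((cmDatum L 3 (Matrix.of fun i j : Fin 3 => if i.val + j.val + 1 = 3 then (1 : L) else 0)).Local v) ⧸ Subgroup.centralizer ({γ} : Set ((cmDatum L 3 (Matrix.of fun i j : Fin 3 => if i.val + j.val + 1 = 3 then (1 : L) else 0)).Local v)))],
          ∀ (S : Finset (ConjClasses ((cmDatum L 3 (Matrix.of fun i j : Fin 3 => if i.val + j.val + 1 = 3 then (1 : L) else 0)).Local v))) (mU : OrbitalMeasureFamily ((cmDatum L 3 (Matrix.of fun i j : Fin 3 => if i.val + j.val + 1 = 3 then (1 : L) else 0)).Local v)),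
            (∀ u ∈ S, (((Quotient.out u : ((cmDatum L 3 (Matrix.of fun i j : Fin 3 => if i.val + j.val + 1 = 3 then (1 : L) else 0)).Local v)).val : GL (Fin 3) (UnitaryGroup.LocalRing L v)).val - 1) ^ 3 = 0) →
            mU.IsAdmissibleOn (fun γ : ((cmDatum L 3 (Matrix.of fun i j : Fin 3 => if i.val + j.val + 1 = 3 then (1 : L) else 0)).Local v) => (ConjClasses.mk γ) ∈ S) →
            (∀ u ∈ S, ∀ f : ((cmDatum L 3 (Matrix.of fun i j : Fin 3 => if i.val + j.val + 1 = 3 then (1 : L) else 0)).Local v) → ℂ, IsLocSmooth f →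
                Integrable (descConj (Quotient.out u : ((cmDatum L 3 (Matrix.of fun i j : Fin 3 => if i.val + j.val + 1 = 3 then (1 : L) else 0)).Local v)) (Subgroup.centralizer ({(Quotient.out u : ((cmDatum L 3 (Matrix.of fun i j : Fin 3 => if i.val + j.val + 1 = 3 then (1 : L) else 0)).Local v))} : Set ((cmDatum L 3 (Matrix.of fun i j : Fin 3 => if i.val + j.val + 1 = 3 then (1 : L) else 0)).Local v)))
                  (fun _ hg => Subgroup.mem_centralizer_singleton_iff.1 hg) f) (mU u)) →
            ∃ fd : ConjClasses ((cmDatum L 3 (Matrix.of fun i j : Fin 3 => if i.val + j.val + 1 = 3 then (1 : L) else 0)).Local v) → ((cmDatum L 3 (Matrix.of fun i j : Fin 3 => if i.val + j.val + 1 = 3 then (1 : L) else 0)).Local v) → ℂ,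
              (∀ u ∈ S, IsLocSmooth (fd u)) ∧ (∀ u ∈ S, classOrbitalIntegral mU (fd u) u = 1) ∧
              (∀ u ∈ S, ∀ u' ∈ S, u ≠ u' → classOrbitalIntegral mU (fd u') u = 0))
    (L : Type) [Field L] [NumberField L] [IsCMField L]
    (v : HeightOneSpectrum (𝓞 ↥(maximalRealSubfield L))) (w : UnitaryGroup.PlacesOver L v) (hsub : Subsingleton (UnitaryGroup.PlacesOver L v)) :
    ShalikaGermExpansionNonsplit L (Matrix.of fun i j : Fin 3 => if i.val + j.val + 1 = 3 then (1 : L) else 0) v := by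
  refine UnitaryGroup.shalikaGermExpansionNonsplit_antidiagOne_three_of_dualPieces ?_ L v w hsub
  intro L _ _ _ v w hsub _ _ _ _ S mU hS hmU hRao
  by_cases hv : Algebra.IsUnramifiedIn (𝓞 L) v.asIdeal
  · exact UnitaryGroup.exists_unipotentDualPieces_antidiagOne_unramified L v w hsub hv S mU hS hmU hRao
  · have he : v.asIdeal.ramificationIdx' w.1.asIdeal ≠ 1 := ramificationIdx'_ne_one_of_not_isUnramifiedIn_of_subsingleton L hsub w hv
    by_cases h2 : IsUnit (2 : 𝒪[w.1.adicCompletion L])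
    · exact UnitaryGroup.exists_unipotentDualPieces_antidiagOne_odd L v w hsub h2 S mU hS hmU hRao
    · exact hdualW L v w hsub he h2 S mU hS hmU hRao

/-! ## §4 (ED. 2) THE BARE HEAD — Shalika at `Φ₃` at every non-split place, in-house -/

/-- **THE SHALIKA GERM EXPANSION FOR `U(Φ₃)(L⁺_v)` AT EVERY NON-SPLIT PLACE — ODD, UNRAMIFIED-DYADIC AND WILD — IN-HOUSE, HYPOTHESIS-FREE.**  For a CM field `L` and a finite place
`v` of `L⁺` with one place `w` of `L` above it: ★ `ShalikaGermExpansionNonsplit L Φ₃ v` ([Rogawski1990] Prop. 8.1.1).  = §2 `…_of_dualPieces` with `hdual` discharged by ★ p850291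
`UnitaryGroup.exists_unipotentDualPieces_antidiagOne_nonsplit` (F0P3a-p04 (g22), dual pieces from the unipotent strata ★ p850263).  The whole Howe package is now ★ at every place:
‹U-FIN› p850231, ‹RAO› p850112∕p849258, ‹SPAN› p850263∕p849233, ‹DUAL› p850291.
[cite: Rogawski1990, §8.1 Prop. 8.1.1 pp. 112–113] [cite: Howe1974, Prop. 2] [cite: Rao1972, Theorem] [cite: HarishChandra1999AdmissibleDistributions, Thm. 8.1 p. 48] -/
theorem UnitaryGroup.shalikaGermExpansionNonsplit_antidiagOne_three (L : Type) [Field L] [NumberField L] [IsCMField L]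
    (v : HeightOneSpectrum (𝓞 ↥(maximalRealSubfield L))) (w : UnitaryGroup.PlacesOver L v) (hsub : Subsingleton (UnitaryGroup.PlacesOver L v)) :
    ShalikaGermExpansionNonsplit L (Matrix.of fun i j : Fin 3 => if i.val + j.val + 1 = 3 then (1 : L) else 0) v :=
  UnitaryGroup.shalikaGermExpansionNonsplit_antidiagOne_three_of_dualPieces UnitaryGroup.exists_unipotentDualPieces_antidiagOne_nonsplit L v w hsub

/-! ## §5 (ED. 3) The print letter `N6nsShalikaStatement` DISCHARGED -/

/-- **THE PRINT LETTER «SHALIKA AT `Φ₃` AT EVERY NON-SPLIT PLACE» IS A THEOREM**: ★ `N6nsShalikaStatement` (`LocalTransferIdentityCoreResidualStatements` — `∀ L v, Subsingleton (PlacesOver L v) →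
ShalikaGermExpansionNonsplit L Φ₃ v`, [Rogawski1990] §8.1 Prop. 8.1.1, until today a bare `def … : Prop` whose only proved slice was the ODD narrowing `N6nsShalikaOddStatement`, ★
`Theorems/F0P3cN6nsShalikaOdd`) holds: §4 at the place `w := Classical.choice (PlacesOver.nonempty L v)`.  In-house end to end: ‹U-FIN› p850231 · ‹RAO› p850112∕p849258 · ‹SPAN› p850263∕p849233 ·
‹DUAL› p850291 · plug ★ `shalikaGermExpansionNonsplit_of_howePackage`. [cite: Rogawski1990, §8.1 Prop. 8.1.1 pp. 112–113] [cite: HarishChandra1999AdmissibleDistributions, Thm. 8.1 p. 48] -/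
theorem n6nsShalikaStatement_holds : N6nsShalikaStatement :=
  fun L _ _ _ v hsub => UnitaryGroup.shalikaGermExpansionNonsplit_antidiagOne_three L v (Classical.choice (PlacesOver.nonempty L v)) hsub

end Literature.NumberTheory.Rogawski1990

end
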